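import Literature.NumberTheory.QuadraticFields.HurwitzClassNumber
import HarnessLib

/-!
# Beckwith–Raum–Richter: non-holomorphic Ramanujan-type congruences of Hurwitz class numbers
# force `ℓ ∣ a` (PNAS 2020, Thm. 1) and `ℓ ∣ b` (Adv. Math. 2022, Thm. 1) — NAMED FACTS

Topic `NumberTheory/QuadraticFields`; route request `wi-81822` (BSD route item
`stmt-BirchSwinnertonDyer-20713`, crux `KS_R`: the even-conductor half of `stub_KSR1` needs an
imaginary quadratic field with `2` and prescribed odd primes split and `ℓ ∤ h`, a ten-line corollary
of the two theorems below — to be proved problem-side). TWO NAMED FACTS (`def … : Prop`, D-0014;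
no proof in the tree: both are proved in print by holomorphic projection of products of theta
series with the weight-`3/2` mock modular Eisenstein series and a theorem of Serre on
`p`-th coefficients of modular forms mod `ℓ`), stated VERBATIM over the sibling file's
`hurwitzClassNumber` (Zagier's `H(N)`, `H(0) = −1/12`, `H(N) = 0` for `N < 0`) and `RatCongZero`
("`x ≡ 0 (mod ℓ)`" for an `ℓ`-integral rational):

* **[BeckwithRaumRichter2020, Thm. 1]** (held `paper:arxiv-2004.06886`, chunk p0001 L47–L55):
  "Fix a prime `ℓ > 3`, `a ∈ ℤ_{≥1}`, and `b ∈ ℤ`. If `−b` is a square modulo `a` and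
  `H(an + b) ≡ 0 (mod ℓ)` for all integers `n`, then `ℓ ∣ a`." — `BRR2020_thm_1`.
* **[BeckwithRaumRichter2022, Thm. 1]** (held `paper:arxiv-2203.11273`, chunk p0002 L38–L46):
  "Let `ℓ > 3` be a prime, `a ∈ ℤ_{≥1}`, and `b ∈ ℤ`. If `−b` is a square modulo `a` and
  `H(an + b) ≡ 0 (mod ℓ)` for all integers `n`, then `ℓ ∣ b`." — `BRR2022_thm_1`.

Typed-vs-printed: "`−b` is a square modulo `a`" = `∃ x : ℤ, a ∣ x² + b`; "for all integers `n`"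
= `∀ n : ℤ` (negative `an + b` contribute `H = 0 ≡ 0`; a progression through `0` never satisfies
the hypothesis since `H(0) = −1/12 ≢ 0`, `not_ratCongZero_hurwitzClassNumber_zero`); the modulus
`a` is ARBITRARY (no parity hypothesis — the `2`-adic sub-progressions are handled in
[BeckwithRaumRichter2020, Lemma 2.3]); `ℓ` and `a` are typed in `ℕ`, `b` in `ℤ`. The printed
examples `H(5³n + 25) ≡ 0 (mod 5)`, `H(7³n + 147) ≡ 0 (mod 7)`, `H(11³n + 242) ≡ 0 (mod 11)`
([BeckwithRaumRichter2020, p0001 L37–L43], proved there by Sturm bounds) show the hypotheses are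
met non-trivially; they are not vendored. (Both theorems are restated, for `ℓ ≥ 3`, as
Theorem 1.3 of Beckwith–Raum–Richter, *Imaginary quadratic fields with ℓ-torsion-free class groups
and specified split primes*, arXiv:2305.19272, held chunk p0005 L51–L53: "Let `ℓ ≥ 3` be prime. If
`aℤ + b` supports a non-holomorphic Ramanujan-type congruence for Hurwitz class numbers modulo `ℓ`,
then `ℓ ∣ a, b`"; that restatement is not used here.)

## References
* [BeckwithRaumRichter2020] O. Beckwith, M. Raum, O. K. Richter, *Nonholomorphic Ramanujan-type
  congruences for Hurwitz class numbers*, Proc. Natl. Acad. Sci. USA 117 (2020),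
  doi:10.1073/pnas.2005984117 = arXiv:2004.06886, Theorem 1.
* [BeckwithRaumRichter2022] O. Beckwith, M. Raum, O. K. Richter, *Congruences of Hurwitz class
  numbers on square classes*, Adv. Math. 409 (2022) 108663, doi:10.1016/j.aim.2022.108663 =
  arXiv:2203.11273, Theorem 1.
-/

namespace Literature.NumberTheory.QuadraticFields

/-- **Beckwith–Raum–Richter 2020, Theorem 1** (verbatim): "Fix a prime `ℓ > 3`, `a ∈ ℤ_{≥1}`, and
`b ∈ ℤ`. If `−b` is a square modulo `a` and `H(an + b) ≡ 0 (mod ℓ)` for all integers `n`, then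
`ℓ ∣ a`." Here `H` = `hurwitzClassNumber` (Zagier's convention) and the congruence of the rational
number `H(an + b)` is `RatCongZero ℓ` (`ℓ`-integral with reduction `0`).
[cite: BeckwithRaumRichter2020, Thm. 1] -/
def BRR2020_thm_1 : Prop :=
  ∀ (ℓ a : ℕ) (b : ℤ), ℓ.Prime → 3 < ℓ → 0 < a → (∃ x : ℤ, (a : ℤ) ∣ x ^ 2 + b) →
    (∀ n : ℤ, RatCongZero ℓ (hurwitzClassNumber (a * n + b))) → ℓ ∣ a

/-- **Beckwith–Raum–Richter 2022, Theorem 1** (verbatim): "Let `ℓ > 3` be a prime, `a ∈ ℤ_{≥1}`,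
and `b ∈ ℤ`. If `−b` is a square modulo `a` and `H(an + b) ≡ 0 (mod ℓ)` for all integers `n`,
then `ℓ ∣ b`." Same vocabulary as `BRR2020_thm_1`. [cite: BeckwithRaumRichter2022, Thm. 1] -/
def BRR2022_thm_1 : Prop :=
  ∀ (ℓ a : ℕ) (b : ℤ), ℓ.Prime → 3 < ℓ → 0 < a → (∃ x : ℤ, (a : ℤ) ∣ x ^ 2 + b) →
    (∀ n : ℤ, RatCongZero ℓ (hurwitzClassNumber (a * n + b))) → (ℓ : ℤ) ∣ b

/-- The two divisibilities together ("`ℓ ∣ a, b`", the form in which Beckwith–Raum–Richter restate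
Theorems 1/1 later): a consumer-facing conjunction of the two named facts.
[cite: BeckwithRaumRichter2022, Thm. 1 and the preceding paragraph (p0002 L36)] -/
theorem dvd_and_dvd_of_hurwitz_congruence (h20 : BRR2020_thm_1) (h22 : BRR2022_thm_1)
    {ℓ a : ℕ} {b : ℤ} (hℓ : ℓ.Prime) (h3 : 3 < ℓ) (ha : 0 < a) (hsq : ∃ x : ℤ, (a : ℤ) ∣ x ^ 2 + b)
    (hcong : ∀ n : ℤ, RatCongZero ℓ (hurwitzClassNumber (a * n + b))) :
    ℓ ∣ a ∧ (ℓ : ℤ) ∣ b :=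
  ⟨h20 ℓ a b hℓ h3 ha hsq hcong, h22 ℓ a b hℓ h3 ha hsq hcong⟩

/-- Under the hypotheses of the theorems the progression `aℤ + b` does not pass through `0`
(`H(0) = −1/12` is not `≡ 0`): `a ∤ b`. A proved remark, independent of the named facts.
[cite: BeckwithRaumRichter2020, Thm. 1 (hypothesis)] -/
theorem not_dvd_of_hurwitz_congruence {ℓ a : ℕ} {b : ℤ} (hℓ : ℓ.Prime)
    (hcong : ∀ n : ℤ, RatCongZero ℓ (hurwitzClassNumber (a * n + b))) : ¬ (a : ℤ) ∣ b := by
  rintro ⟨c, hc⟩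
  have h := hcong (-c)
  rw [hc, show (a : ℤ) * -c + a * c = 0 by ring] at h
  exact not_ratCongZero_hurwitzClassNumber_zero hℓ h

end Literature.NumberTheory.QuadraticFields
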